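import Mathlib
import HarnessLib
import Literature.Probability.LatticeModels.LatticeGreenFunction
import Summits.QuantumFields.YangMills.Theses.LangevinControlUV

/-!
# Route `LangevinControlUV`, crux `FemtoCurvatureTwoPoint` (stmt-QuantumFields-9363): vocabulary of line `generic-step-gamma-encoding`, I

Route-posited statements (D-0016 `<Route><Crux>Defs` file) of the skeleton
`Cruxes/FemtoCurvatureTwoPoint/Lines/generic_step_gamma_encoding.lean` (planner
`planner-cruxplan-stmt-QuantumFields-9363-generic-step-gamma-e-0`; leads `prover-line-stmt-QuantumFields-9363-0`, `…-c1-0`, `…-c2-0`),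
VERBATIM the skeleton's `def … : Prop` declarations in the SAME namespace
`Summit.QuantumFields.YangMills.Cruxes.FemtoCurvatureTwoPoint.GenericStepGammaEncoding`, so that the stub signatures registered
on the crux item keep their meaning and the line's sorry-free composition (companion files `…TwoPointEncoding*.lean`,
`…TwoPointReduction*.lean`) becomes landable from `Theorems/`. NOTHING here is asserted: every `def … : Prop` is a line
statement that some registered stub proves or consumes (several are already theorems of the tree, spelled out:
`Theorems.FemtoCurvatureTwoPoint.stub_maxwellKernelBand` p94229 = `MaxwellKernelBand`, `.stub_wickSquares` p111302 =
`WickSquares`, `.stub_fieldStrengthCovariance` p110989 = `FieldStrengthCovariance`, `.stub_offAxisDomination` =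
`OffAxisDomination`); none is a literature fact; none restates the crux as a claim — `femtoCurvatureTwoPoint_iff_cruxAt`
is `Iff.rfl` up to bundling (`CruxAt r` is the crux body at fixed `(G, r)`).

This file (part I) holds the TWO-POINT vocabulary: the fixed-torus targets `AxisLowerFixedTorus` (K2⁻),
`PairUpperFixedTorus` (K2⁺), their conjunction `FixedTorusTwoSided` (the card's C⁺), the kernel band `MaxwellKernelBand`
(K1a), the Gaussian lower bound `AxisGaussianLower` (GD⁻) and its factorisation `WickSquares` (W) ∧
`FieldStrengthCovariance` (F) ∧ `AxisGaussianDomination` (GD-dom, OPEN core), the off-axis domination `OffAxisDomination`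
(OA) and the diagonal upper bounds `DiagUpperFixedTorus` (DU) ⇐ `DiagUpperTwoProfiles` (DU₂). Part II
(`…TwoPointDefsDU.lean`) holds the even-torus variance route and the per-torus limit form of the core.

Refs: line card `Cruxes/FemtoCurvatureTwoPoint/Lines/generic-step-gamma-encoding.md`; crux notes
`Cruxes/FemtoCurvatureTwoPoint/NOTES.md`; `Cruxes/FemtoCurvatureTwoPoint/Disproof.lean` (gen 2, § Dissection: any proof must be
a fixed-torus two-sided statement with `L`-uniform constants — exactly `FixedTorusTwoSided`).
-/

set_option autoImplicit false

noncomputable section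

open scoped BigOperators Matrix
open MeasureTheory Filter Topology ProbabilityTheory

namespace Summit.QuantumFields.YangMills.Cruxes.FemtoCurvatureTwoPoint.GenericStepGammaEncoding

open Literature.MathematicalPhysics.QuantumFieldTheory

/-- **K1a — lattice Maxwell kernel band** (readable copy of the statement of `stub_maxwellKernelBand`;
identical, character for character up to layout, to `stub_maxwellKernelBand` of line
`deep-band-gaussian-regime`). -/
def MaxwellKernelBand : Prop :=
  ∃ (c C : ℝ), 0 < c ∧ ∀ (L : ℕ) [NeZero L] (e₀ e₁ : Fin 4 → ZMod L) (K : (Fin 4 → ZMod L) → ℝ),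
      e₀ = Pi.single (0 : Fin 4) (1 : ZMod L) → e₁ = Pi.single (1 : Fin 4) (1 : ZMod L) →
      (K = fun z =>
        ((2 * Literature.Probability.LatticeModels.torusGreen z
            - Literature.Probability.LatticeModels.torusGreen (z + e₀)
            - Literature.Probability.LatticeModels.torusGreen (z - e₀))
          + (2 * Literature.Probability.LatticeModels.torusGreen z
            - Literature.Probability.LatticeModels.torusGreen (z + e₁)
            - Literature.Probability.LatticeModels.torusGreen (z - e₁))) / 2) →
      ∀ (n : ℕ), 1 ≤ n → 8 * n ≤ L →
        c ≤ (n : ℝ) ^ 4 * K (Pi.single (2 : Fin 4) ((n : ℕ) : ZMod L)) ∧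
          (n : ℝ) ^ 4 * K (Pi.single (2 : Fin 4) ((n : ℕ) : ZMod L)) ≤ C

/-- **K2⁻ — fixed-torus axis LOWER bound, `L`-uniform constant** (readable copy of the conclusion of
`stub_axisLower`). For every compact simple `G` (any Borel structure) and faithful unitary `r` there
are per-torus thresholds `B(L)` and ONE `c > 0` such that on every torus `(ℤ/L)⁴`, for `β ≥ B(L)`:
`c ≤ β² · n⁸ · Cov_{L,β}(P_0^{01}, P_{ne₂}^{01})` for `1 ≤ n`, `8n ≤ L`
(`P`, `E` enter through defining equations). -/
def AxisLowerFixedTorus : Prop :=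
  ∀ (G : Type) [Group G] [TopologicalSpace G] [IsTopologicalGroup G] [CompactSpace G]
      [MeasurableSpace G] [BorelSpace G], IsCompactSimpleLieGroup G →
    ∀ (r : LatticeRep G), ∃ (B : ℕ → ℝ) (c : ℝ), 0 < c ∧
      ∀ (L : ℕ) [NeZero L] (β : ℝ), B L ≤ β →
      ∀ (P : (Fin 4 → ZMod L) → Fin 4 → Fin 4 → GaugeConfig 4 L G → ℝ)
        (E : (GaugeConfig 4 L G → ℝ) → ℝ),
        (P = fun x i j U => (r.N : ℝ) - (r.ρ (plaquetteHolonomy U x i j)).trace.re) →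
        (E = fun F => wilsonExpectation r.ρ β F) →
      ∀ (n : ℕ), 1 ≤ n → 8 * n ≤ L →
        c ≤ β ^ 2 * ((n : ℝ) ^ 8 *
          (E (fun U => P 0 0 1 U * P (Pi.single (2 : Fin 4) ((n : ℕ) : ZMod L)) 0 1 U) -
            E (P 0 0 1) * E (P (Pi.single (2 : Fin 4) ((n : ℕ) : ZMod L)) 0 1)))

/-- **K2⁺ — fixed-torus all-pairs UPPER bound, `L`-uniform constant** (readable copy of the
conclusion of `stub_pairUpper`), on EVERY torus `L ≥ 1` including `L < 8`. -/
def PairUpperFixedTorus : Prop :=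
  ∀ (G : Type) [Group G] [TopologicalSpace G] [IsTopologicalGroup G] [CompactSpace G]
      [MeasurableSpace G] [BorelSpace G], IsCompactSimpleLieGroup G →
    ∀ (r : LatticeRep G), ∃ (B : ℕ → ℝ) (C : ℝ),
      ∀ (L : ℕ) [NeZero L] (β : ℝ), B L ≤ β →
      ∀ (P : (Fin 4 → ZMod L) → Fin 4 → Fin 4 → GaugeConfig 4 L G → ℝ)
        (E : (GaugeConfig 4 L G → ℝ) → ℝ),
        (P = fun x i j U => (r.N : ℝ) - (r.ρ (plaquetteHolonomy U x i j)).trace.re) →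
        (E = fun F => wilsonExpectation r.ρ β F) →
      ∀ (x y : Fin 4 → ZMod L) (i j i' j' : Fin 4), x ≠ y → i ≠ j → i' ≠ j' →
        β ^ 2 * (|E (fun U => P x i j U * P y i' j' U) - E (P x i j) * E (P y i' j')|
          * Real.sqrt (∑ k : Fin 4, (((x k - y k).valMinAbs : ℤ) : ℝ) ^ 2) ^ 8) ≤ C

/-- **GD⁻ — fixed-torus Gaussian domination from BELOW on the axis** (until reshape c2 the statement of
the stub `stub_axisGaussianLower`; since c2 the glued consequence `axisGaussianLower_of_stubs` of W, F,
GD-dom; the crux-sized residue of K2⁻). For every compact simple `G` and faithful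
unitary `r` there is ONE `κ > 0` and per-torus thresholds `B(L)` such that for `β ≥ B(L)`,
`1 ≤ n ≤ L/8`: `κ · K_L(n e₂)² ≤ β² · Cov_{L,β}(P_0^{01}, P_{ne₂}^{01})`, `K_L` the tree-level
plaquette kernel of K1a. Content: second-order Laplace asymptotics of Wilson's measure on `G^E` near
the (non-Morse–Bott) flat-connection variety — leading Gaussian term `(dim G/2)·⟨K_{L,θ}(ne₂)²⟩_θ β⁻²`
(law of total covariance over the flat background `θ`; the toron part `Var_θ E[P|θ] ≥ 0` adds
positively on the axis; twisted kernels within `O(L⁻⁴)` of `K_L`). Not in print for any non-abelian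
`G` (fixed-lattice `β → ∞` asymptotics exist only for the free energy). -/
def AxisGaussianLower : Prop :=
  ∀ (G : Type) [Group G] [TopologicalSpace G] [IsTopologicalGroup G] [CompactSpace G]
      [MeasurableSpace G] [BorelSpace G], IsCompactSimpleLieGroup G →
    ∀ (r : LatticeRep G), ∃ κ : ℝ, 0 < κ ∧ ∀ (L : ℕ) [NeZero L], ∃ B : ℝ, ∀ (β : ℝ), B ≤ β →
      ∀ (n : ℕ), 1 ≤ n → 8 * n ≤ L →
        κ * (((2 * Literature.Probability.LatticeModels.torusGreen
                  (Pi.single (2 : Fin 4) ((n : ℕ) : ZMod L) : Fin 4 → ZMod L)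
                - Literature.Probability.LatticeModels.torusGreen
                  ((Pi.single (2 : Fin 4) ((n : ℕ) : ZMod L) : Fin 4 → ZMod L)
                    + Pi.single (0 : Fin 4) (1 : ZMod L))
                - Literature.Probability.LatticeModels.torusGreen
                  ((Pi.single (2 : Fin 4) ((n : ℕ) : ZMod L) : Fin 4 → ZMod L)
                    - Pi.single (0 : Fin 4) (1 : ZMod L)))
              + (2 * Literature.Probability.LatticeModels.torusGreen
                  (Pi.single (2 : Fin 4) ((n : ℕ) : ZMod L) : Fin 4 → ZMod L)
                - Literature.Probability.LatticeModels.torusGreen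
                  ((Pi.single (2 : Fin 4) ((n : ℕ) : ZMod L) : Fin 4 → ZMod L)
                    + Pi.single (1 : Fin 4) (1 : ZMod L))
                - Literature.Probability.LatticeModels.torusGreen
                  ((Pi.single (2 : Fin 4) ((n : ℕ) : ZMod L) : Fin 4 → ZMod L)
                    - Pi.single (1 : Fin 4) (1 : ZMod L)))) / 2) ^ 2
          ≤ β ^ 2 *
            (wilsonExpectation r.ρ β (fun U : GaugeConfig 4 L G =>
                ((r.N : ℝ) - (r.ρ (plaquetteHolonomy U 0 0 1)).trace.re) *
                  ((r.N : ℝ) - (r.ρ (plaquetteHolonomy U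
                    (Pi.single (2 : Fin 4) ((n : ℕ) : ZMod L)) 0 1)).trace.re))
              - wilsonExpectation r.ρ β (fun U : GaugeConfig 4 L G =>
                  (r.N : ℝ) - (r.ρ (plaquetteHolonomy U 0 0 1)).trace.re)
                * wilsonExpectation r.ρ β (fun U : GaugeConfig 4 L G =>
                  (r.N : ℝ) - (r.ρ (plaquetteHolonomy U
                    (Pi.single (2 : Fin 4) ((n : ℕ) : ZMod L)) 0 1)).trace.re))

/-- **W — Wick / Isserlis covariance of squares** (readable copy of the statement of `stub_wickSquares`;
reshape c2). For a centred multivariate Gaussian vector `a` on `ι` with (positive semidefinite)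
covariance matrix `S` and two linear functionals `X = ∑ uᵢ aᵢ`, `Y = ∑ vᵢ aᵢ`:
`E[X² Y²] − E[X²] E[Y²] = 2 (uᵀ S v)² = 2 Cov(X, Y)²` (Isserlis 1918; Wick 1950). Provable now from
Mathlib's `multivariateGaussian` (polarisation `12 X²Y² = (X+Y)⁴ + (X−Y)⁴ − 2X⁴ − 2Y⁴` and the
fourth moment `3σ⁴` of `gaussianReal`). -/
def WickSquares : Prop :=
  ∀ (ι : Type) [Fintype ι] [DecidableEq ι] (S : Matrix ι ι ℝ), S.PosSemidef →
    ∀ (u v : ι → ℝ),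
      (∫ x, (∑ i, u i * x i) ^ 2 * (∑ i, v i * x i) ^ 2 ∂(multivariateGaussian 0 S))
        - (∫ x, (∑ i, u i * x i) ^ 2 ∂(multivariateGaussian 0 S))
          * (∫ x, (∑ i, v i * x i) ^ 2 ∂(multivariateGaussian 0 S))
      = 2 * (u ⬝ᵥ S *ᵥ v) ^ 2

/-- **F — the reference lattice Maxwell covariance and its field-strength kernel** (readable copy of
the statement of `stub_fieldStrengthCovariance`; reshape c2). On the torus `(ℤ/L)⁴`, the Feynman-gauge
covariance of the Gaussian 1-form `a`, `S_L((x,μ),(y,ν)) = δ_{μν} G_L(x − y)` with `G_L = torusGreen`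
(twice the Green function of `−Δ` on mean-zero functions), is positive semidefinite (Fourier sum with
weights `1/ε(p_k) ≥ 0`), and for the plaquette field strength
`F₀₁(x) = a(x,0) + a(x+e₀,1) − a(x+e₁,0) − a(x,1)` (coefficient vector `u x`):
`⟨F₀₁(x) F₀₁(y)⟩ = (u x)ᵀ S_L (u y) = 2 K_L(x − y)`, `K_L` the K1a kernel (half the sum of the two
negative second differences of `G_L` in the plaquette directions). Provable now (finite sums). -/
def FieldStrengthCovariance : Prop :=
  ∀ (L : ℕ) [NeZero L] (S : Matrix (Edge 4 L) (Edge 4 L) ℝ) (u : (Fin 4 → ZMod L) → Edge 4 L → ℝ),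
    (S = fun e e' => if e.2 = e'.2 then
        Literature.Probability.LatticeModels.torusGreen (e.1 - e'.1) else 0) →
    (u = fun x e =>
        (if e = (x, (0 : Fin 4)) then (1 : ℝ) else 0)
        + (if e = (x + Pi.single (0 : Fin 4) (1 : ZMod L), (1 : Fin 4)) then 1 else 0)
        - (if e = (x + Pi.single (1 : Fin 4) (1 : ZMod L), (0 : Fin 4)) then 1 else 0)
        - (if e = (x, (1 : Fin 4)) then 1 else 0)) →
    S.PosSemidef ∧
    ∀ (x y : Fin 4 → ZMod L),
      u x ⬝ᵥ S *ᵥ u y =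
        2 * (((2 * Literature.Probability.LatticeModels.torusGreen (x - y)
              - Literature.Probability.LatticeModels.torusGreen
                  ((x - y) + Pi.single (0 : Fin 4) (1 : ZMod L))
              - Literature.Probability.LatticeModels.torusGreen
                  ((x - y) - Pi.single (0 : Fin 4) (1 : ZMod L)))
            + (2 * Literature.Probability.LatticeModels.torusGreen (x - y)
              - Literature.Probability.LatticeModels.torusGreen
                  ((x - y) + Pi.single (1 : Fin 4) (1 : ZMod L))
              - Literature.Probability.LatticeModels.torusGreen
                  ((x - y) - Pi.single (1 : Fin 4) (1 : ZMod L)))) / 2)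

/-- **GD-dom — Gaussian domination from BELOW of the axis covariance (the crux-sized core of GD⁻;
readable copy of the statement of `stub_axisGaussianDomination`; reshape c2).** For every compact simple
`G` and faithful unitary `r` there is ONE `κ > 0` and per-torus thresholds `B(L)` such that for
`β ≥ B(L)`, `1 ≤ n ≤ L/8`:
`κ · Cov_{γ_L}(F₀₁(ne₂)², F₀₁(0)²) ≤ β² · Cov_{L,β}(P_0^{01}, P_{ne₂}^{01})`, where `γ_L =
multivariateGaussian 0 S_L` is the reference lattice Maxwell field of `FieldStrengthCovariance` (ONE
colour; the `dim G` colours and the normalisation `P ≈ |F|²/(2β)` are absorbed in `κ`). By W and F the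
left side is `8κ K_L(ne₂)²`, so GD-dom is GD⁻ with the reference-Gaussian computation factored out
(`axisGaussianLower_of_domination`). Content (unchanged): second-order Laplace asymptotics of Wilson's
measure on `G^E` near the singular flat-connection variety — leading Gaussian term by the law of total
covariance over the flat background, toron part `≥ 0` on the axis, twisted kernels within `O(L⁻⁴)`.
Not in print for any non-abelian `G`. -/
def AxisGaussianDomination : Prop :=
  ∀ (G : Type) [Group G] [TopologicalSpace G] [IsTopologicalGroup G] [CompactSpace G]
      [MeasurableSpace G] [BorelSpace G], IsCompactSimpleLieGroup G →
    ∀ (r : LatticeRep G), ∃ κ : ℝ, 0 < κ ∧ ∀ (L : ℕ) [NeZero L], ∃ B : ℝ, ∀ (β : ℝ), B ≤ β →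
      ∀ (S : Matrix (Edge 4 L) (Edge 4 L) ℝ) (u : (Fin 4 → ZMod L) → Edge 4 L → ℝ),
      (S = fun e e' => if e.2 = e'.2 then
          Literature.Probability.LatticeModels.torusGreen (e.1 - e'.1) else 0) →
      (u = fun x e =>
          (if e = (x, (0 : Fin 4)) then (1 : ℝ) else 0)
          + (if e = (x + Pi.single (0 : Fin 4) (1 : ZMod L), (1 : Fin 4)) then 1 else 0)
          - (if e = (x + Pi.single (1 : Fin 4) (1 : ZMod L), (0 : Fin 4)) then 1 else 0)
          - (if e = (x, (1 : Fin 4)) then 1 else 0)) →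
      ∀ (n : ℕ), 1 ≤ n → 8 * n ≤ L →
        κ * ((∫ a, (∑ e, u (Pi.single (2 : Fin 4) ((n : ℕ) : ZMod L)) e * a e) ^ 2
                  * (∑ e, u 0 e * a e) ^ 2 ∂(multivariateGaussian 0 S))
              - (∫ a, (∑ e, u (Pi.single (2 : Fin 4) ((n : ℕ) : ZMod L)) e * a e) ^ 2
                    ∂(multivariateGaussian 0 S))
                * (∫ a, (∑ e, u 0 e * a e) ^ 2 ∂(multivariateGaussian 0 S)))
          ≤ β ^ 2 *
            (wilsonExpectation r.ρ β (fun U : GaugeConfig 4 L G =>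
                ((r.N : ℝ) - (r.ρ (plaquetteHolonomy U 0 0 1)).trace.re) *
                  ((r.N : ℝ) - (r.ρ (plaquetteHolonomy U
                    (Pi.single (2 : Fin 4) ((n : ℕ) : ZMod L)) 0 1)).trace.re))
              - wilsonExpectation r.ρ β (fun U : GaugeConfig 4 L G =>
                  (r.N : ℝ) - (r.ρ (plaquetteHolonomy U 0 0 1)).trace.re)
                * wilsonExpectation r.ρ β (fun U : GaugeConfig 4 L G =>
                  (r.N : ℝ) - (r.ρ (plaquetteHolonomy U
                    (Pi.single (2 : Fin 4) ((n : ℕ) : ZMod L)) 0 1)).trace.re))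

/-- **OA — off-axis domination (reflection-positivity Cauchy–Schwarz; β-uniform, every compact `G`).**
For every direction `μ` in which the two base points differ (`m = |(y−x)_μ| ≥ 1`, torus distance in
that coordinate), the covariance of ANY two plaquette fields is dominated by the diagonal (same-family)
covariances along `μ` in the window `{m−1, m, m+1}`:
`Cov(P_x^{ij}, P_y^{i'j'})² ≤ (Σ_{s=m−1}^{m+1} |D^{ij}_μ(s)|) · (Σ_{s=m−1}^{m+1} |D^{i'j'}_μ(s)|)`,
`D^{ij}_μ(s) = Cov(P_0^{ij}, P_{s e_μ}^{ij})`. -/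
def OffAxisDomination : Prop :=
  ∀ (G : Type) [Group G] [TopologicalSpace G] [IsTopologicalGroup G] [CompactSpace G]
      [MeasurableSpace G] [BorelSpace G] (N : ℕ) (ρ : G →* Matrix (Fin N) (Fin N) ℂ), Continuous ρ →
    ∀ (L : ℕ) [NeZero L] (β : ℝ), 0 ≤ β →
      ∀ (P : (Fin 4 → ZMod L) → Fin 4 → Fin 4 → GaugeConfig 4 L G → ℝ)
        (E : (GaugeConfig 4 L G → ℝ) → ℝ),
        (P = fun x i j U => (N : ℝ) - (ρ (plaquetteHolonomy U x i j)).trace.re) →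
        (E = fun F => wilsonExpectation ρ β F) →
      ∀ (μ : Fin 4) (x y : Fin 4 → ZMod L) (i j i' j' : Fin 4), i ≠ j → i' ≠ j' →
        1 ≤ ((y μ - x μ).valMinAbs).natAbs →
        (E (fun U => P x i j U * P y i' j' U) - E (P x i j) * E (P y i' j')) ^ 2 ≤
          (∑ s ∈ Finset.range 3,
              |E (fun U => P 0 i j U *
                  P (Pi.single μ ((((y μ - x μ).valMinAbs).natAbs - 1 + s : ℕ) : ZMod L)) i j U)
                - E (P 0 i j) *
                  E (P (Pi.single μ ((((y μ - x μ).valMinAbs).natAbs - 1 + s : ℕ) : ZMod L)) i j)|) *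
          (∑ s ∈ Finset.range 3,
              |E (fun U => P 0 i' j' U *
                  P (Pi.single μ ((((y μ - x μ).valMinAbs).natAbs - 1 + s : ℕ) : ZMod L)) i' j' U)
                - E (P 0 i' j') *
                  E (P (Pi.single μ ((((y μ - x μ).valMinAbs).natAbs - 1 + s : ℕ) : ZMod L)) i' j')|)

/-- **DU — fixed-torus upper bounds for the DIAGONAL families only (the XL residue of K2⁺).** ONE `C`,
per-torus thresholds: `β² Var P ≤ C` and `β² |D^{ij}_μ(s)| · min(s, L−s)⁸ ≤ C` for `1 ≤ s ≤ L−1`,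
all 24 families `(i, j, μ)`. -/
def DiagUpperFixedTorus : Prop :=
  ∀ (G : Type) [Group G] [TopologicalSpace G] [IsTopologicalGroup G] [CompactSpace G]
      [MeasurableSpace G] [BorelSpace G], IsCompactSimpleLieGroup G →
    ∀ (r : LatticeRep G), ∃ (B : ℕ → ℝ) (C : ℝ),
      ∀ (L : ℕ) [NeZero L] (β : ℝ), B L ≤ β →
      ∀ (P : (Fin 4 → ZMod L) → Fin 4 → Fin 4 → GaugeConfig 4 L G → ℝ)
        (E : (GaugeConfig 4 L G → ℝ) → ℝ),
        (P = fun x i j U => (r.N : ℝ) - (r.ρ (plaquetteHolonomy U x i j)).trace.re) →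
        (E = fun F => wilsonExpectation r.ρ β F) →
      (∀ (i j : Fin 4), i ≠ j →
          β ^ 2 * |E (fun U => P 0 i j U * P 0 i j U) - E (P 0 i j) * E (P 0 i j)| ≤ C) ∧
      (∀ (i j μ : Fin 4) (s : ℕ), i ≠ j → 1 ≤ s → s + 1 ≤ L →
          β ^ 2 * (|E (fun U => P 0 i j U * P (Pi.single μ ((s : ℕ) : ZMod L)) i j U)
              - E (P 0 i j) * E (P (Pi.single μ ((s : ℕ) : ZMod L)) i j)|
            * (min (s : ℝ) ((L : ℝ) - s)) ^ 8) ≤ C)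

/-- **DU₂ — fixed-torus upper bounds for the TWO diagonal profiles (reshape c1, second pass).** ONE
`C`, per-torus thresholds: `β² Var P_0^{01} ≤ C`, and for `1 ≤ s ≤ L − 1` the transverse profile
`β² |Cov(P_0^{01}, P_{s e₂}^{01})| · min(s, L−s)⁸ ≤ C` (the crux's own axis family) and the longitudinal
profile `β² |Cov(P_0^{01}, P_{s e₀}^{01})| · min(s, L−s)⁸ ≤ C`. By the landed hypercubic reduction
`Theorems.FemtoCurvatureTwoPoint.diagFamilies_two_profiles` this is equivalent to the 24-family
statement `DiagUpperFixedTorus` (glue `diagUpper_of_twoProfiles` below). -/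
def DiagUpperTwoProfiles : Prop :=
  ∀ (G : Type) [Group G] [TopologicalSpace G] [IsTopologicalGroup G] [CompactSpace G]
      [MeasurableSpace G] [BorelSpace G], IsCompactSimpleLieGroup G →
    ∀ (r : LatticeRep G), ∃ (B : ℕ → ℝ) (C : ℝ),
      ∀ (L : ℕ) [NeZero L] (β : ℝ), B L ≤ β →
      ∀ (P : (Fin 4 → ZMod L) → Fin 4 → Fin 4 → GaugeConfig 4 L G → ℝ)
        (E : (GaugeConfig 4 L G → ℝ) → ℝ),
        (P = fun x i j U => (r.N : ℝ) - (r.ρ (plaquetteHolonomy U x i j)).trace.re) →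
        (E = fun F => wilsonExpectation r.ρ β F) →
      β ^ 2 * |E (fun U => P 0 0 1 U * P 0 0 1 U) - E (P 0 0 1) * E (P 0 0 1)| ≤ C ∧
      ∀ (s : ℕ), 1 ≤ s → s + 1 ≤ L →
        β ^ 2 * (|E (fun U => P 0 0 1 U * P (Pi.single (2 : Fin 4) ((s : ℕ) : ZMod L)) 0 1 U)
            - E (P 0 0 1) * E (P (Pi.single (2 : Fin 4) ((s : ℕ) : ZMod L)) 0 1)|
          * (min (s : ℝ) ((L : ℝ) - s)) ^ 8) ≤ C ∧
        β ^ 2 * (|E (fun U => P 0 0 1 U * P (Pi.single (0 : Fin 4) ((s : ℕ) : ZMod L)) 0 1 U)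
            - E (P 0 0 1) * E (P (Pi.single (0 : Fin 4) ((s : ℕ) : ZMod L)) 0 1)|
          * (min (s : ℝ) ((L : ℝ) - s)) ^ 8) ≤ C

/-- **C⁺ of the card (`FixedTorusSemiclassicalTwoPoint`, sharpened threshold form).** Both
clauses with ONE pair of constants `0 < c`, `C` uniform in `L`, each torus from its own
threshold `B(L)` on. No unit map, no shape, no coupling between `β` and `L`. -/
def FixedTorusTwoSided : Prop :=
  ∀ (G : Type) [Group G] [TopologicalSpace G] [IsTopologicalGroup G] [CompactSpace G],
    IsCompactSimpleLieGroup G →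
    letI : MeasurableSpace G := borel G
    haveI : BorelSpace G := ⟨rfl⟩
    ∀ (r : LatticeRep G), ∃ (B : ℕ → ℝ) (c C : ℝ), 0 < c ∧
      ∀ (L : ℕ) [NeZero L] (β : ℝ), B L ≤ β →
        let P : (Fin 4 → ZMod L) → Fin 4 → Fin 4 → GaugeConfig 4 L G → ℝ :=
          fun x i j U => (r.N : ℝ) - (r.ρ (plaquetteHolonomy U x i j)).trace.re
        let E : (GaugeConfig 4 L G → ℝ) → ℝ := fun F => wilsonExpectation (d := 4) (L := L) r.ρ β F
        let cov : (GaugeConfig 4 L G → ℝ) → (GaugeConfig 4 L G → ℝ) → ℝ :=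
          fun F F' => E (fun U => F U * F' U) - E F * E F'
        let dist : (Fin 4 → ZMod L) → (Fin 4 → ZMod L) → ℝ :=
          fun x y => Real.sqrt (∑ k : Fin 4, (((x k - y k).valMinAbs : ℤ) : ℝ) ^ 2)
        (∀ n : ℕ, 1 ≤ n → 8 * n ≤ L →
            c ≤ β ^ 2 * ((n : ℝ) ^ 8 * cov (P 0 0 1) (P (Pi.single (2 : Fin 4) ((n : ℕ) : ZMod L)) 0 1)) ∧
            β ^ 2 * ((n : ℝ) ^ 8 * cov (P 0 0 1) (P (Pi.single (2 : Fin 4) ((n : ℕ) : ZMod L)) 0 1)) ≤ C) ∧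
        (∀ (x y : Fin 4 → ZMod L) (i j i' j' : Fin 4), x ≠ y → i ≠ j → i' ≠ j' →
            β ^ 2 * (|cov (P x i j) (P y i' j')| * dist x y ^ 8) ≤ C)

/-- The crux BODY at fixed data `(G, r)` (verbatim; `femtoCurvatureTwoPoint_iff_cruxAt` is `Iff.rfl`).
Used only to state the fixed-data form `encoding_at` of the transfer. -/
def CruxAt {G : Type} [Group G] [TopologicalSpace G] [IsTopologicalGroup G] [CompactSpace G]
    [MeasurableSpace G] [BorelSpace G] (r : LatticeRep G) : Prop :=
  ∃ (a : ℝ → ℝ), ∃ (Γ : ℝ → ℝ) (β₀ ℓ₀ c C : ℝ), 0 < ℓ₀ ∧ 0 < c ∧ (∀ β, 0 < a β) ∧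
    Filter.Tendsto a Filter.atTop (nhds 0) ∧ (∀ s : ℝ, 0 < s → s ≤ ℓ₀ → 0 < Γ s ∧ Γ s ≤ 1) ∧
    ∀ (L : ℕ) [NeZero L] (β : ℝ), β₀ ≤ β → (L : ℝ) * a β ≤ ℓ₀ →
      let P : (Fin 4 → ZMod L) → Fin 4 → Fin 4 → GaugeConfig 4 L G → ℝ :=
        fun x i j U => (r.N : ℝ) - (r.ρ (plaquetteHolonomy U x i j)).trace.re
      let E : (GaugeConfig 4 L G → ℝ) → ℝ := fun F => wilsonExpectation (d := 4) (L := L) r.ρ β F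
      let cov : (GaugeConfig 4 L G → ℝ) → (GaugeConfig 4 L G → ℝ) → ℝ :=
        fun F F' => E (fun U => F U * F' U) - E F * E F'
      let dist : (Fin 4 → ZMod L) → (Fin 4 → ZMod L) → ℝ :=
        fun x y => Real.sqrt (∑ k : Fin 4, (((x k - y k).valMinAbs : ℤ) : ℝ) ^ 2)
      (∀ n : ℕ, 1 ≤ n → 8 * n ≤ L →
          c * Γ ((n : ℝ) * a β) ≤ (n : ℝ) ^ 8 * cov (P 0 0 1) (P (Pi.single (2 : Fin 4) ((n : ℕ) : ZMod L)) 0 1) ∧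
          (n : ℝ) ^ 8 * cov (P 0 0 1) (P (Pi.single (2 : Fin 4) ((n : ℕ) : ZMod L)) 0 1) ≤ C * Γ ((n : ℝ) * a β)) ∧
      (∀ (x y : Fin 4 → ZMod L) (i j i' j' : Fin 4), x ≠ y → i ≠ j → i' ≠ j' →
          |cov (P x i j) (P y i' j')| * dist x y ^ 8 ≤ C * Γ (dist x y * a β))

/-- The crux is literally `∀ G simple compact, ∀ r, CruxAt r` (definitional unbundling, as in
`Disproof.femtoCurvatureTwoPoint_iff`). -/
theorem femtoCurvatureTwoPoint_iff_cruxAt :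
    Summit.QuantumFields.YangMills.Theses.LangevinControlUV.FemtoCurvatureTwoPoint ↔
      ∀ (G : Type) [Group G] [TopologicalSpace G] [IsTopologicalGroup G] [CompactSpace G],
        IsCompactSimpleLieGroup G →
          letI : MeasurableSpace G := borel G
          haveI : BorelSpace G := ⟨rfl⟩
          ∀ r : LatticeRep G, CruxAt r :=
  Iff.rfl

end Summit.QuantumFields.YangMills.Cruxes.FemtoCurvatureTwoPoint.GenericStepGammaEncoding

end
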